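import Mathlib.LinearAlgebra.TensorProduct.RightExactness
import Mathlib.RingTheory.Flat.Basic
import Mathlib.LinearAlgebra.Basis.VectorSpace
import Mathlib.RingTheory.Ideal.Quotient.Operations
import HarnessLib

/-!
# Regular pairs in a tensor product of algebras over a field

For algebras `A`, `B` over a field `k`, a nonzerodivisor `u ∈ A` and a nonzerodivisor `v ∈ B`,
the pair `(u ⊗ 1, 1 ⊗ v)` is a **regular sequence** of `A ⊗ₖ B`: `u ⊗ 1` is a nonzerodivisor
and `1 ⊗ v` is a nonzerodivisor modulo `u ⊗ 1` (flatness of everything over a field and the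
right exactness of `⊗`, Mathlib `Module.Flat.rTensor_preserves_injective_linearMap`,
`Algebra.TensorProduct.rTensor_ker`); and `(A ⊗ₖ B)/(u ⊗ 1, 1 ⊗ v) ≅ A/(u) ⊗ₖ B/(v)`
(Mathlib `Algebra.TensorProduct.map_ker`). This is the local algebra of the centre
`Xʳₘ × X⁰ₘ = {x_{r+2} = 0} × {y₂ = 0} ⊂ Xʳ⁺¹ₘ × X¹ₘ` of Shioda–Katsura's blow-up
(Tôhoku Math. J. 31 (1979), §1 (1.4)): a product of transversal hyperplane sections is a
complete intersection of codimension `2`.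

* `tmul_one_mem_nonZeroDivisors`, `one_tmul_mem_nonZeroDivisors`;
* `dvd_of_tmul_one_dvd_mul_one_tmul`, `dvd_of_one_tmul_dvd_mul_tmul_one` (regular pair, both
  orders);
* `exists_ringEquiv_quotient_tensor` — `(A ⊗ B)/(u ⊗ 1, 1 ⊗ v) ≅ A/(u) ⊗ B/(v)` on pure
  tensors.

## References

* T. Shioda, T. Katsura, On Fermat varieties, Tôhoku Math. J. 31 (1979) 97–115, §1 (1.4).
  [ShiodaKatsura1979]
* H. Matsumura, *Commutative Ring Theory* (1987), §16 (regular sequences) and Thm. 7.4 (i)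
  (flat base change preserves injectivity). [Matsumura1987]
-/

noncomputable section

open TensorProduct Algebra.TensorProduct

namespace Literature.AlgebraicGeometry.Motives.TensorRegularPair

universe u v w

variable {k : Type u} [Field k] {A : Type v} {B : Type w} [CommRing A] [CommRing B]
  [Algebra k A] [Algebra k B]

/-- Multiplication by `u ⊗ 1` on `A ⊗ B` is `(u ·) ⊗ id`. [folklore] -/
theorem rTensor_mulLeft (u : A) :
    (LinearMap.mulLeft k u).rTensor B = LinearMap.mulLeft k (u ⊗ₜ[k] (1 : B)) := by
  refine TensorProduct.ext' fun a b ↦ ?_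
  simp [LinearMap.rTensor_tmul]

/-- Multiplication by `1 ⊗ v` on `A ⊗ B` is `id ⊗ (v ·)`. [folklore] -/
theorem lTensor_mulLeft (v : B) :
    (LinearMap.mulLeft k v).lTensor A = LinearMap.mulLeft k ((1 : A) ⊗ₜ[k] v) := by
  refine TensorProduct.ext' fun a b ↦ ?_
  simp [LinearMap.lTensor_tmul]

/-- In a commutative ring, `r` is a nonzerodivisor iff multiplication by `r` is injective.
[folklore] -/
theorem mem_nonZeroDivisors_iff_injective_mulLeft {R : Type*} [CommRing R] [Algebra k R] (r : R) :
    r ∈ nonZeroDivisors R ↔ Function.Injective (LinearMap.mulLeft k r) := by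
  rw [mem_nonZeroDivisors_iff_left, injective_iff_map_eq_zero]
  rfl

/-- **`u ⊗ 1` is a nonzerodivisor of `A ⊗ₖ B`** if `u` is a nonzerodivisor of `A` (`B` is flat
over the field `k`). [cite: Matsumura1987, Thm. 7.4 (i)] -/
theorem tmul_one_mem_nonZeroDivisors {u : A} (hu : u ∈ nonZeroDivisors A) :
    u ⊗ₜ[k] (1 : B) ∈ nonZeroDivisors (A ⊗[k] B) := by
  have h := Module.Flat.rTensor_preserves_injective_linearMap (M := B) (LinearMap.mulLeft k u)
    ((mem_nonZeroDivisors_iff_injective_mulLeft (k := k) u).mp hu)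
  rw [rTensor_mulLeft] at h
  exact (mem_nonZeroDivisors_iff_injective_mulLeft (k := k) _).mpr h

/-- **`1 ⊗ v` is a nonzerodivisor of `A ⊗ₖ B`** if `v` is a nonzerodivisor of `B`.
[cite: Matsumura1987, Thm. 7.4 (i)] -/
theorem one_tmul_mem_nonZeroDivisors {v : B} (hv : v ∈ nonZeroDivisors B) :
    (1 : A) ⊗ₜ[k] v ∈ nonZeroDivisors (A ⊗[k] B) := by
  have h := Module.Flat.lTensor_preserves_injective_linearMap (M := A) (LinearMap.mulLeft k v)
    ((mem_nonZeroDivisors_iff_injective_mulLeft (k := k) v).mp hv)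
  rw [lTensor_mulLeft] at h
  exact (mem_nonZeroDivisors_iff_injective_mulLeft (k := k) _).mpr h

/-- `ker (A → A/I) = I` for the `k`-algebra quotient map (Mathlib `Ideal.Quotient.mkₐ_ker`, in the
`AlgHom` form of `RingHom.ker`). [folklore] -/
theorem ker_mkₐ {R : Type*} [CommRing R] [Algebra k R] (I : Ideal R) :
    RingHom.ker (Ideal.Quotient.mkₐ k I) = I :=
  Ideal.Quotient.mkₐ_ker k I

/-- The ideal `(u ⊗ 1) ⊆ A ⊗ B` is the kernel of `A ⊗ B → A/(u) ⊗ B`. [folklore] -/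
theorem span_tmul_one_eq_ker (u : A) :
    Ideal.span {u ⊗ₜ[k] (1 : B)} =
      RingHom.ker (map (Ideal.Quotient.mkₐ k (Ideal.span {u})) (AlgHom.id k B)) := by
  rw [Algebra.TensorProduct.rTensor_ker _ Ideal.Quotient.mk_surjective, ker_mkₐ,
    Ideal.map_span, Set.image_singleton]
  rfl

/-- The ideal `(1 ⊗ v) ⊆ A ⊗ B` is the kernel of `A ⊗ B → A ⊗ B/(v)`. [folklore] -/
theorem span_one_tmul_eq_ker (v : B) :
    Ideal.span {(1 : A) ⊗ₜ[k] v} =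
      RingHom.ker (map (AlgHom.id k A) (Ideal.Quotient.mkₐ k (Ideal.span {v}))) := by
  rw [Algebra.TensorProduct.lTensor_ker _ Ideal.Quotient.mk_surjective, ker_mkₐ,
    Ideal.map_span, Set.image_singleton]
  rfl

/-- **`(u ⊗ 1, 1 ⊗ v)` is a regular pair**: if `v` is a nonzerodivisor of `B` then `1 ⊗ v` is a
nonzerodivisor modulo `u ⊗ 1`, i.e. `u ⊗ 1 ∣ r · (1 ⊗ v)` implies `u ⊗ 1 ∣ r` (work in
`(A ⊗ B)/(u ⊗ 1) = A/(u) ⊗ B`, where `1 ⊗ v` is a nonzerodivisor). [cite: Matsumura1987, §16] -/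
theorem dvd_of_tmul_one_dvd_mul_one_tmul (u : A) {v : B} (hv : v ∈ nonZeroDivisors B)
    (r : A ⊗[k] B) (h : u ⊗ₜ[k] (1 : B) ∣ r * ((1 : A) ⊗ₜ[k] v)) : u ⊗ₜ[k] (1 : B) ∣ r := by
  rw [← Ideal.mem_span_singleton, span_tmul_one_eq_ker, RingHom.mem_ker] at h ⊢
  rw [map_mul] at h
  have hv' := one_tmul_mem_nonZeroDivisors (k := k) (A := A ⧸ Ideal.span {u}) hv
  have himg : map (Ideal.Quotient.mkₐ k (Ideal.span {u})) (AlgHom.id k B) ((1 : A) ⊗ₜ[k] v) =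
      (1 : A ⧸ Ideal.span {u}) ⊗ₜ[k] v := by
    rw [Algebra.TensorProduct.map_tmul, map_one, AlgHom.id_apply]
  rw [himg] at h
  exact (mem_nonZeroDivisors_iff_right.mp hv') _ h

/-- The same with the roles of the factors exchanged: `1 ⊗ v ∣ r · (u ⊗ 1)` implies `1 ⊗ v ∣ r`
if `u` is a nonzerodivisor of `A`. [cite: Matsumura1987, §16] -/
theorem dvd_of_one_tmul_dvd_mul_tmul_one {u : A} (hu : u ∈ nonZeroDivisors A) (v : B)
    (r : A ⊗[k] B) (h : (1 : A) ⊗ₜ[k] v ∣ r * (u ⊗ₜ[k] (1 : B))) : (1 : A) ⊗ₜ[k] v ∣ r := by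
  rw [← Ideal.mem_span_singleton, span_one_tmul_eq_ker, RingHom.mem_ker] at h ⊢
  rw [map_mul] at h
  have hu' := tmul_one_mem_nonZeroDivisors (k := k) (B := B ⧸ Ideal.span {v}) hu
  have himg : map (AlgHom.id k A) (Ideal.Quotient.mkₐ k (Ideal.span {v})) (u ⊗ₜ[k] (1 : B)) =
      u ⊗ₜ[k] (1 : B ⧸ Ideal.span {v}) := by
    rw [Algebra.TensorProduct.map_tmul, map_one, AlgHom.id_apply]
  rw [himg] at h
  exact (mem_nonZeroDivisors_iff_right.mp hu') _ h

/-- **`(A ⊗ B)/(u ⊗ 1, 1 ⊗ v) ≅ A/(u) ⊗ B/(v)`** (Mathlib `Algebra.TensorProduct.map_ker`), with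
`a ⊗ b ↦ ā ⊗ b̄`. [folklore] -/
theorem exists_ringEquiv_quotient_tensor (u : A) (v : B) :
    ∃ e : ((A ⊗[k] B) ⧸ Ideal.span {u ⊗ₜ[k] (1 : B), (1 : A) ⊗ₜ[k] v}) ≃+*
        (A ⧸ Ideal.span {u}) ⊗[k] (B ⧸ Ideal.span {v}),
      ∀ a b, e (Ideal.Quotient.mk _ (a ⊗ₜ b)) = Ideal.Quotient.mk _ a ⊗ₜ Ideal.Quotient.mk _ b := by
  set φ := map (Ideal.Quotient.mkₐ k (Ideal.span {u})) (Ideal.Quotient.mkₐ k (Ideal.span {v}))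
    with hφ
  have hsurj : Function.Surjective φ :=
    Algebra.TensorProduct.map_surjective _ _ Ideal.Quotient.mk_surjective Ideal.Quotient.mk_surjective
  have hker : RingHom.ker φ = Ideal.span {u ⊗ₜ[k] (1 : B), (1 : A) ⊗ₜ[k] v} := by
    rw [hφ, Algebra.TensorProduct.map_ker _ _ Ideal.Quotient.mk_surjective Ideal.Quotient.mk_surjective,
      ker_mkₐ, ker_mkₐ, Ideal.map_span, Ideal.map_span,
      Set.image_singleton, Set.image_singleton, ← Ideal.span_union, Set.singleton_union]
    rfl
  refine ⟨(Ideal.quotEquivOfEq hker.symm).trans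
    (Ideal.quotientKerAlgEquivOfSurjective hsurj).toRingEquiv, fun a b ↦ ?_⟩
  rw [RingEquiv.trans_apply, Ideal.quotEquivOfEq_mk]
  change Ideal.quotientKerAlgEquivOfSurjective hsurj (Ideal.Quotient.mk _ (a ⊗ₜ b)) = _
  rw [Ideal.quotientKerAlgEquivOfSurjective_mk]
  rfl

end Literature.AlgebraicGeometry.Motives.TensorRegularPair

end
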